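import Summits.AtomisticToContinuum.Crystallization.Theorems.FreeSplittingCertificatesDefectVanishOfStrict
import Summits.AtomisticToContinuum.Crystallization.Theorems.FreeSplittingCertificatesStrictSplittingRuleDefs
import Summits.AtomisticToContinuum.Crystallization.Theorems.ChessboardParticlePlanesLjLaminarWindowsMinDistance

/-!
# decomp-a2c · lens-6 «barrier-complement carving» · generation 28 · node «StrictSplittingOnPathKernel»
# on crux `StrictSplittingRule` (stmt-AtomisticToContinuum-12560, route `FreeSplittingCertificates`, the
# route's ONLY open load-bearing binder of `closes`)

Critic rows 391 (3)(ii) / 392 (2) (decomp-a2c STATUS l.1856 / l.1859), writer INBOX l.407 / l.410.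
Question put to the lens: carve `12560` beneath `G ClosePackingCertificate ⊇ r2 FiniteRangeSplitting`
(line `Cruxes/StrictSplittingRule/Lines/close_packing.lean`, glue landed p167747) into pieces outside the
catalogued barriers, or certify the axis BARRIER; decide COSTUME / KNOWN / WEAKER / CRYSTALLIZATION-HARD for
the G-kernel against the cell's bottoms {FDG, BULK|door, QUAL}; (a) which of FEASIBILITY (global) /
RIGIDITY (near-floor sites) is load-bearing for `closes`; (b) degenerate regimes (razor = large fcc balls);
(c) misstatement check.

## What this file PROVES (0 sorry; every arrow a theorem of this file or of the tree, cited by name)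

The ON-PATH KERNEL CHAIN of `12560` — what `closes (h₁ : StrictSplittingRule) (h₂ … h₆ : proved)`
actually consumes — and its sufficiency for the conjunct BY NAME:

```
StrictSplittingRule (12560)                                   [finite-range rule; ALL δ; ALL δ-separated configs]
  ⟹ K₁ RuleCertificateGS        (tree: groundStateCertificate_of_strictSplittingRule)   [rule, any radius, GROUND STATES only]
  ⟹ K₂ FreeStrictCertificateGS  (freeStrictCertificateGS_of_ruleCertificateGS)         [configuration-dependent weights: NO locality]
  ⟹ K₃ HcpShellPricingGS        (hcpShellPricingGS_of_freeStrictCertificateGS)          [summed: c(η)·#{non-η-hcp shells} ≤ E(N) − N·e_∞]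
  ⟹ H  HcpShellDefectVanish     (hcpShellDefectVanish_of_hcpShellPricingGS)             [density of non-η-hcp(a,t) first shells → 0]
H ∧ ShellRigidityHcp (PROVED, 12561) ⟹ DefectVanish(P)    (defectVanish_of_hcpShellDefectVanish; hence the glue
                                 item DefectVanishOfStrict 12566 through the kernel: see the landing NOTE after defectVanish_of_hcpShellDefectVanish)
  ⟹ Crystallization BY NAME      (crystallization_of_hcpShellDefectVanish — binders = those of `closes` with
                                 h₁ 12560, h₃ 12566 ↦ h : H; h₂ h₄ h₅ h₆ are PROVED route items)
H ⟸ TP TwoPatternShellDefectVanish ∧ SEL FccShellsVanish   (hcpShellDefectVanish_of_twoPattern_of_fccVanish)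
H ⟹ TP                                                      (twoPattern_of_hcpShellDefectVanish)
```

So NEITHER the finite range `R` of the rule, NOR feasibility on non-ground-state configurations, NOR the
`∀ δ` quantifier, NOR even the certificate / LP structure is load-bearing: the LP layer is ELIMINABLE (the
counting lemma `defectVanishOfStrict_count` of the route runs verbatim on the FAKE site energies
`e_∞ + 𝟙[shell of k not η-close]`, theorem `defectVanish_of_hcpShellDefectVanish`).  What `closes` needs
from `12560` is exactly the density statement `H`; the SURPLUS `12560 ∖ H` = {locality at finite range =
the r2 / G kernel, sitewise feasibility and strictness on every `δ`-separated configuration} is OFF-PATH.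

## Tags (doctrine D-0170: COSTUME(cite) / WEAKER(evidence) / UNDECIDED(test); leaves ATTACKABLE /
## INSTRUMENTABLE / IDEA-NEEDED / BARRIER)

* `12560 StrictSplittingRule` — STRONGER than its on-path kernel (this file) · its surplus is exposed to the
  RAZOR (tree, `StrictSplittingRuleBirth.bravaisGap_of_strictSplittingRule`, quoted in the razor section
  below): strictness on ALL `δ`-separated configurations forces `c(a/5) ≤ e(Λ) − e_∞`
  for EVERY `δ`-separated Bravais lattice `Λ`, numerically `c ≤ e*_fcc − e*_hcp ≈ 7.25·10⁻⁵`
  (refuter evidence `lattice_check.out` on the item; `Lines/close_packing.md`: c₁ ≤ 7.25e−5, Δ₂ ≈ 7.27e−5)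
  — critic (b) «is c(η) ≤ e_fcc − e_hcp forced?»: YES for `12560` as typed (intrinsic scale), NO for the
  kernel `K₁…H` (ground states only) unless fcc balls are ground states.  Leaf status of the SURPLUS
  (r2 / G kernel = «Lennard-Jones is an exact finite-range m-potential relative to e_∞ on δ-separated
  configurations»): OFF-PATH (proved here) · UNDECIDED · INSTRUMENTABLE (b2b LP/LMI certificates, kit
  j027933) · BARRIER-CLASS «local rules / finite-range m-potentials need not exist or force order»
  (`Literature.Barriers.AtomisticToContinuum.AperiodicTilingGroundStates` — Radin 1991, Miękisz J. Stat.
  Phys. 90 (1998) ultimate frustration; `…ShortRangeStackingBlindness` for the polytype part at range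
  `< √(8/3)`; `…LocalizedPotentialsExcludeLennardJones` for the perturbative far-field transfer of F).
* `K₁ RuleCertificateGS` — WEAKER than 12560 (evidence: the razor theorem quantifies over non-ground-state
  Bravais balls, to which K₁ says nothing; K₁ keeps ONE hard core `7/10` = `LjLaminarWindowsSketch.stub_minDistance07`).
* `K₂ FreeStrictCertificateGS` — WEAKER than K₁ (evidence: locality dropped — with configuration-dependent
  weights FEASIBILITY ALONE IS FREE for every configuration, route support `FreePairSplitting` PROVED
  (Gale–Hoffman), while finite-range feasibility r2 is open; only STRICTNESS with a uniform `c(η)` has content).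
  By finite LP duality (Hoffman's circulation theorem, not formalised here) K₂ ⟺ a rule-free PRICED-CUT
  inequality on ground states; its cut `A = univ` is K₃.
* `K₃ HcpShellPricingGS` — COSTUME of the cell's DEFECT-PRICING bottom restricted to ground states, hcp-only,
  floor `e_∞`: `SpectralChargeLedger.SummedShellPricing` (all δ-separated configurations, fcc ∨ hcp, floor
  e⋆ = e_∞ by `crysEnergyLimit_proof`), FDG = `ChargedEnergyGap (14231) ∧ KR_shape` (writer TREE v1.39 dichotomy
  column).  WEAKER than K₂ (sub-cluster cuts dropped).
* `H HcpShellDefectVanish` — COSTUME, modulo shell conventions (radius `5a/4` + `ShellCloseTo η` here vs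
  `13/10·d_i` + bijective `1/20`-matching there), of `TwoPatternShellLadder.ZeroDefectDensity (12086) ∧
  StrainRelease (24071)` ∧ hcp-SELECTION; UNDECIDED (test: census of first-shell types in putative LJ_N minima is
  ≈ 100 % non-hcp for icosahedral N ≤ 10³ — `Literature.Barriers.AtomisticToContinuum.IcosahedralClusters` — so
  only the asymptotic statement is testable: instrument = two-pattern finite-range certificates, b2b).
  H is NOT weaker than the conjunct (H ⟹ Crystallization, this file) ⇒ by doctrine it is split:
* `TP TwoPatternShellDefectVanish` — WEAKER than H (proved: `twoPattern_of_hcpShellDefectVanish`; strictly: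
  TP is consistent with fcc-dominated ground states, H is not) · not known to imply the conjunct ·
  UNDECIDED · INSTRUMENTABLE · COSTUME-class of 12086 (lens-1 line N_C.C).
* `SEL FccShellsVanish` — «fcc-type first shells have vanishing density in Lennard-Jones ground states»:
  not known to imply the conjunct (trivially true for amorphous ground states) · UNDECIDED (test: sign and
  sitewise certifiability of `e*_fcc − e*_hcp ≈ +7.25·10⁻⁵` incl. the r⁻⁶ tail — tree-side dependency
  `HcpFccLatticeSums*`, NEEDS-HUMAN build) · COSTUME of the POLYTYPE-SELECTION axis: F
  `PolytypePerturbativeCertificate` (Lines/close_packing.lean), `26655 PeriodicSelection`, `LjRegistryDomination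
  3063`, with `SpectralChargeLedger.ShellsToLayers (17254)` PROVED turning two-pattern shells into layers ·
  leaf IDEA-NEEDED (hcp vs fcc for LJ₆,₁₂ is a 10⁻⁴-relative lattice-sum fact with no structural proof in print).

VERDICT for the critic (row 392 (2)): (a) load-bearing for `closes` = STRICTNESS-on-ground-states in its summed
form K₃/H (+ RIGIDITY X₂, proved); global FEASIBILITY and LOCALITY are not; (b) razor confirmed as a theorem
of the tree, biting the surplus only; (c) NOT misstated (e_∞ = ⨅_M E(M+1)/(M+1) = lim E(N)/N = ⨅_Q e(Q) by
`BlancLewin2015_8_holds` + `crysEnergyLimit_proof`; site energy = full pair sum × finite-range weight).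
G-kernel verdict: NOT crystallization-hard energetically (summed feasibility `E ≥ N·e_∞` is trivial), it is
LOCALITY-hard and OFF-PATH; the close-packing split G ∧ F stays a LINE for proving 12560, not a route-level
necessity.  N_C1 := FreeSplittingCertificates contributes NO independent bottom to the cell tree: its open
content maps onto DEFECT-DENSITY (TP/K₃ ~ 12086, SummedShellPricing, FDG) × SELECTION (SEL ~ F/26655/3063).
RECOMMENDATION (tenure / writer): re-glue option `closes (h : HcpShellDefectVanish) (h₂ : ShellRigidityHcp)
(h₄ : DefectVanishCrystallizes) (h₅ : DefectVanishEnergy) (h₆ : PeriodicUpperBound) := crystallization_of_hcpShellDefectVanish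
h h₂ h₄ h₅ h₆` (h₂ h₄ h₅ h₆ proved) with `12560 → H` (`hcpShellDefectVanish_of_strictSplittingRule`) kept as the
certificate LINE on H.

WHY NOVEL: the tree's `…RadiusLadderGroundStateCore` stops at RULE certificates on ground states (K₁); this
file removes the rule, the radius and the LP layer altogether (K₂ → K₃ → H, fake-site-energy counting), proves
`H → Crystallization` by name, and places every rung against the cell's existing bottoms — a certified
«no independent bottom» reading of N_C1 rather than a new statement to staff.
All proofs are `[folklore]` bookkeeping over landed theorems.

LANDING (decomp-a2c hand-1 g9, critic rows 406 (3) / 412 (2)): lens-6 g28 node `StrictSplittingOnPathKernel.lean`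
(sha256 9b7472f7…) split at the 400-line cap into THIS module (kernel K₁–K₃, H, the chain, `H ∧ h₂ ⟹ Crystallization`)
and `FreeSplittingCertificatesOnPathKernelSplit.lean` (razor note, doctrine split TP ∧ SEL, OUTRIGHT corollaries
`H → Crystallization` with the four proved route items discharged by name); namespace and every FQN unchanged;
the six statement pieces carry `@[conjecture]` (obligation nodes of our theory).
-/

noncomputable section

namespace Summit.AtomisticToContinuum.Crystallization.Theorems.StrictSplittingOnPathKernel

open scoped BigOperators Topology Classical
open Filter
open Literature.MathematicalPhysics.StatisticalMechanics
open Literature.Geometry.DiscreteGeometry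
open Summit.AtomisticToContinuum.Crystallization.Theses.FreeSplittingCertificates
open Summit.AtomisticToContinuum.Crystallization.Theorems
open Summit.AtomisticToContinuum.Crystallization.Theorems.StrictSplittingRuleBirth

/-! ## The four kernel statements -/

/-- **K₁ (piece, WEAKER than 12560)** — a pair-splitting RULE `Φ` (box + complementarity) of SOME radius `R`,
feasible (`siteE ≥ e_∞`) and strict toward the stretched hcp shell `S(a,t)` at the sites of Lennard-Jones
GROUND STATES only.  Verbatim the conclusion of the tree's `groundStateCertificate_of_strictSplittingRule`. -/
@[conjecture] def RuleCertificateGS : Prop :=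
  ∃ (R : ℝ) (Φ : EuclideanSpace ℝ (Fin 3) → Finset (EuclideanSpace ℝ (Fin 3)) → ℝ) (a t : ℝ),
    0 < a ∧ |t| ≤ 1 / 100 ∧ IsRule Φ ∧
    (∀ (N : ℕ) (x : Fin N → EuclideanSpace ℝ (Fin 3)), IsGroundState lennardJones x →
      ∀ i : Fin N, eInf ≤ siteE R Φ x i) ∧
    (∀ η : ℝ, 0 < η → ∃ c : ℝ, 0 < c ∧
      ∀ (N : ℕ) (x : Fin N → EuclideanSpace ℝ (Fin 3)), IsGroundState lennardJones x →
        ∀ k : Fin N, siteE R Φ x k < eInf + c → ShellCloseTo η (shell a x k) (target a t))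

/-- Weighted site energy for an ARBITRARY (configuration-dependent) weight matrix `w`:
`∑_{j ≠ i} w i j · V_LJ(|x_i − x_j|)`. -/
def freeSiteE {N : ℕ} (w : Fin N → Fin N → ℝ) (x : Fin N → EuclideanSpace ℝ (Fin 3)) (i : Fin N) : ℝ :=
  ∑ j ∈ Finset.univ.erase i, w i j * lennardJones (dist (x i) (x j))

/-- **K₂ (piece, WEAKER than K₁: locality dropped)** — FREE STRICT CERTIFICATES ON GROUND STATES: for some
`(a,t)` and every `η > 0` a constant `c(η) > 0` such that every Lennard-Jones ground state `x` admits bond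
weights `w i j ≥ 0`, `w i j + w j i = 1` (chosen per configuration and per `η` — no rule, no radius) with
`freeSiteE w x i ≥ e_∞` at every site and `freeSiteE w x k < e_∞ + c(η) ⇒` the `5a/4`-shell of `k` is
`η`-close to `S(a,t)`. -/
@[conjecture] def FreeStrictCertificateGS : Prop :=
  ∃ a t : ℝ, 0 < a ∧ |t| ≤ 1 / 100 ∧ ∀ η : ℝ, 0 < η → ∃ c : ℝ, 0 < c ∧
    ∀ (N : ℕ) (x : Fin N → EuclideanSpace ℝ (Fin 3)), IsGroundState lennardJones x →
      ∃ w : Fin N → Fin N → ℝ,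
        (∀ i j, i ≠ j → 0 ≤ w i j ∧ w i j + w j i = 1) ∧
        (∀ i, eInf ≤ freeSiteE w x i) ∧
        (∀ k, freeSiteE w x k < eInf + c → ShellCloseTo η (shell a x k) (target a t))

/-- **K₃ (piece, summed form; COSTUME of the cell's defect-pricing bottom restricted to ground states)** —
HCP SHELL PRICING ON GROUND STATES: for some `(a,t)`, every `η > 0` has a price `c(η) > 0` with
`c(η) · #{k : 5a/4-shell of k not η-close to S(a,t)} ≤ E(N) − N·e_∞` for every Lennard-Jones ground state
of `N` particles. -/
@[conjecture] def HcpShellPricingGS : Prop :=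
  ∃ a t : ℝ, 0 < a ∧ |t| ≤ 1 / 100 ∧ ∀ η : ℝ, 0 < η → ∃ c : ℝ, 0 < c ∧
    ∀ (N : ℕ) (x : Fin N → EuclideanSpace ℝ (Fin 3)), IsGroundState lennardJones x →
      c * (Nat.card {k : Fin N // ¬ ShellCloseTo η (shell a x k) (target a t)} : ℝ) ≤
        groundStateEnergy lennardJones 3 N - N * eInf

/-- **H (the on-path kernel of 12560; COSTUME-class of 12086 ∧ 24071 ∧ hcp-selection)** — HCP SHELL DEFECT
VANISHING: for some `a > 0`, `|t| ≤ 1/100` and every `η > 0`, along every sequence of Lennard-Jones ground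
states the fraction of sites whose `5a/4`-shell is not `η`-close (up to a linear isometry) to the stretched
hcp shell `S(a,t)` tends to `0`. -/
@[conjecture] def HcpShellDefectVanish : Prop :=
  ∃ a t : ℝ, 0 < a ∧ |t| ≤ 1 / 100 ∧ ∀ η : ℝ, 0 < η →
    ∀ x : (N : ℕ) → (Fin N → EuclideanSpace ℝ (Fin 3)), (∀ N, IsGroundState lennardJones (x N)) →
      Tendsto (fun N : ℕ =>
        (Nat.card {k : Fin N // ¬ ShellCloseTo η (shell a (x N) k) (target a t)} : ℝ) / N) atTop (𝓝 0)

/-! ## The chain `12560 ⟹ K₁ ⟹ K₂ ⟹ K₃ ⟹ H` -/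

/-- `12560 ⟹ K₁` (= the tree's `StrictSplittingRuleBirth.groundStateCertificate_of_strictSplittingRule` of
`…RadiusLadderGroundStateCore`, re-proved here to keep the imports light: the `δ = 7/10` instance of the crux
restricted to ground states, which are `7/10`-separated by `LjLaminarWindowsSketch.stub_minDistance07`). [folklore] -/
theorem ruleCertificateGS_of_strictSplittingRule (h : StrictSplittingRule) : RuleCertificateGS := by
  obtain ⟨R, Φ, a, t, -, ha, ht, hrule, hfeas, hstrict⟩ :=
    strictSplittingRule_iff.mp h (7 / 10) (by norm_num)
  refine ⟨R, Φ, a, t, ha, ht, hrule,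
    fun N x hx i => hfeas N x (LjLaminarWindowsSketch.stub_minDistance07 N x hx) i, fun η hη => ?_⟩
  obtain ⟨c, hc, hstr⟩ := hstrict η hη
  exact ⟨c, hc, fun N x hx k hk => hstr N x (LjLaminarWindowsSketch.stub_minDistance07 N x hx) k hk⟩

/-- `K₁ ⟹ K₂`: read the rule's bond weights on the realised patterns; box from `IsRule`, complementarity
on realised patterns from `defectVanishOfStrict_weights_compl`. [folklore] -/
theorem freeStrictCertificateGS_of_ruleCertificateGS (h : RuleCertificateGS) : FreeStrictCertificateGS := by
  obtain ⟨R, Φ, a, t, ha, ht, hrule, hfeas, hstrict⟩ := h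
  refine ⟨a, t, ha, ht, fun η hη => ?_⟩
  obtain ⟨c, hc, hstr⟩ := hstrict η hη
  refine ⟨c, hc, fun N x hx => ?_⟩
  refine ⟨fun i j => Φ (x j - x i) ((Finset.univ.filter fun l =>
      dist (x l) (x i) ≤ R ∨ dist (x l) (x j) ≤ R).image fun l => x l - x i), ?_, ?_, ?_⟩
  · intro i j hij
    exact ⟨(hrule.1 _ _).1, defectVanishOfStrict_weights_compl x hx.1 R Φ hrule.2 i j hij⟩
  · intro i
    exact hfeas N x hx i
  · intro k hk
    exact hstr N x hx k hk

/-- `K₂ ⟹ K₃`: complementary weights sum the weighted site energies to `E(N)` (`defectVanishOfStrict_sum_weighted_eq`);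
feasibility makes every slack non-negative; Markov (the route's `defectVanishOfStrict_count` with the trivial
neighbourhood `near k i := k = i`, `K = 1`). [folklore] -/
theorem hcpShellPricingGS_of_freeStrictCertificateGS (h : FreeStrictCertificateGS) : HcpShellPricingGS := by
  obtain ⟨a, t, ha, ht, hstrict⟩ := h
  refine ⟨a, t, ha, ht, fun η hη => ?_⟩
  obtain ⟨c, hc, hcert⟩ := hstrict η hη
  refine ⟨c, hc, fun N x hx => ?_⟩
  obtain ⟨w, hw, hfeas, hstr⟩ := hcert N x hx
  have hsum : ∑ k, freeSiteE w x k ≤ groundStateEnergy lennardJones 3 N := by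
    have h1 := defectVanishOfStrict_sum_weighted_eq lennardJones x w (fun i j hij => (hw i j hij).2)
    rw [hx.2] at h1
    exact le_of_eq h1
  have hcnt := defectVanishOfStrict_count (fun k => freeSiteE w x k) eInf c
    (groundStateEnergy lennardJones 3 N) 1 hc zero_le_one
    (fun k => ShellCloseTo η (shell a x k) (target a t)) (fun k => ShellCloseTo η (shell a x k) (target a t))
    (fun k i => k = i) hfeas hsum hstr (fun i hi => hi i rfl)
    (fun k => ⟨{k}, fun i hi => by simp [hi], by simp⟩)
  have hmul := mul_le_mul_of_nonneg_left hcnt hc.le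
  calc c * (Nat.card {k : Fin N // ¬ ShellCloseTo η (shell a x k) (target a t)} : ℝ)
      ≤ c * (1 / c * (groundStateEnergy lennardJones 3 N - N * eInf)) := hmul
    _ = groundStateEnergy lennardJones 3 N - N * eInf := by
        rw [← mul_assoc, mul_one_div_cancel hc.ne', one_mul]

/-- `K₃ ⟹ H`: divide by `N`; `E(N)/N → e ≤ e_∞` (`BlancLewin2015_8_holds`; `e ≤ e_∞ = ⨅_M E(M+1)/(M+1)`).
[folklore] -/
theorem hcpShellDefectVanish_of_hcpShellPricingGS (h : HcpShellPricingGS) : HcpShellDefectVanish := by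
  obtain ⟨a, t, ha, ht, hprice⟩ := h
  refine ⟨a, t, ha, ht, fun η hη x hx => ?_⟩
  obtain ⟨c, hc, hcN⟩ := hprice η hη
  obtain ⟨e, -, htend, hle⟩ := BlancLewin2015_8_holds 3 (by norm_num) (by norm_num)
  have he : e ≤ eInf := le_ciInf fun M => hle (M + 1) M.succ_pos
  have main : ∀ N : ℕ, 0 < N →
      (Nat.card {k : Fin N // ¬ ShellCloseTo η (shell a (x N) k) (target a t)} : ℝ) / N ≤
        1 / c * (groundStateEnergy lennardJones 3 N / N - e) := by
    intro N hN
    have hNr : (0 : ℝ) < N := by exact_mod_cast hN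
    have h1 := hcN N (x N) (hx N)
    have hNe : (N : ℝ) * e ≤ N * eInf := mul_le_mul_of_nonneg_left he hNr.le
    have h2 : (Nat.card {k : Fin N // ¬ ShellCloseTo η (shell a (x N) k) (target a t)} : ℝ) ≤
        1 / c * (groundStateEnergy lennardJones 3 N - N * e) := by
      rw [one_div, ← div_eq_inv_mul, le_div_iff₀ hc, mul_comm]
      linarith
    calc (Nat.card {k : Fin N // ¬ ShellCloseTo η (shell a (x N) k) (target a t)} : ℝ) / N
        ≤ 1 / c * (groundStateEnergy lennardJones 3 N - N * e) / N :=
          div_le_div_of_nonneg_right h2 hNr.le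
      _ = 1 / c * (groundStateEnergy lennardJones 3 N / N - e) := by
          rw [mul_div_assoc, sub_div, mul_div_cancel_left₀ _ hNr.ne']
  refine squeeze_zero' (Eventually.of_forall fun N => by positivity)
    ((eventually_gt_atTop 0).mono main) ?_
  have hlim := (htend.sub_const e).const_mul (1 / c)
  rwa [sub_self, mul_zero] at hlim

/-- The on-path kernel of the crux: `12560 ⟹ H`. [folklore] -/
theorem hcpShellDefectVanish_of_strictSplittingRule (h : StrictSplittingRule) : HcpShellDefectVanish :=
  hcpShellDefectVanish_of_hcpShellPricingGS (hcpShellPricingGS_of_freeStrictCertificateGS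
    (freeStrictCertificateGS_of_ruleCertificateGS (ruleCertificateGS_of_strictSplittingRule h)))

/-! ## `H ∧ ShellRigidityHcp ⟹ Crystallization` — the LP layer is eliminable -/

/-- **Defect vanishing from shell-defect vanishing.**  `H` and `ShellRigidityHcp` give one periodic `P` whose
windows match all but a vanishing fraction of the sites along every ground-state sequence (the conclusion of
the route's `DefectVanishOfStrict`).  Proof: the route's counting lemma `defectVanishOfStrict_count` applied to
the FAKE site energies `W k = e_∞` (good shell) / `e_∞ + 1` (bad shell) with `c = 1` and the fake total
`N·e_∞ + #bad` — no certificate is needed; hard core `7/10` of ground states from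
`LjLaminarWindowsSketch.stub_minDistance07`, packing from `defectVanishOfStrict_card_near_le`. [folklore] -/
theorem defectVanish_of_hcpShellDefectVanish (h : HcpShellDefectVanish) (h₂ : ShellRigidityHcp) :
    ∃ P : PeriodicConfiguration 3, (∀ R' ε' : ℝ, 0 < R' → 0 < ε' →
      ∀ x : (N : ℕ) → (Fin N → EuclideanSpace ℝ (Fin 3)),
        (∀ N, IsGroundState lennardJones (x N)) →
          Filter.Tendsto (fun N : ℕ => (Nat.card {i : Fin N // ¬ (∃ q ∈ P.points,
            ∃ A : EuclideanSpace ℝ (Fin 3) →ₗᵢ[ℝ] EuclideanSpace ℝ (Fin 3),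
              (∀ p ∈ P.points, dist p q ≤ R' → ∃ j, dist (x N j) (x N i + A (p - q)) ≤ ε') ∧
              (∀ j, dist (x N j) (x N i) ≤ R' → ∃ p ∈ P.points,
                dist (x N j) (x N i + A (p - q)) ≤ ε'))} : ℝ) / N) Filter.atTop (nhds 0)) := by
  obtain ⟨a, t, ha, ht, hH⟩ := h
  obtain ⟨P, hP⟩ := h₂ a t ha ht
  refine ⟨P, fun R' ε' hR' hε' x hx => ?_⟩
  obtain ⟨η, hη, L, hL⟩ := hP (7 / 10) R' ε' (by norm_num) hR' hε'
  have hlimH := hH η hη x hx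
  set K : ℝ := (2 * max L 0 / (7 / 10) + 1) ^ 3 with hK_def
  have hK : 0 ≤ K := by positivity
  have main : ∀ N : ℕ, 0 < N →
      (Nat.card {i : Fin N // ¬ (∃ q ∈ P.points,
        ∃ A : EuclideanSpace ℝ (Fin 3) →ₗᵢ[ℝ] EuclideanSpace ℝ (Fin 3),
          (∀ p ∈ P.points, dist p q ≤ R' → ∃ j, dist (x N j) (x N i + A (p - q)) ≤ ε') ∧
          (∀ j, dist (x N j) (x N i) ≤ R' → ∃ p ∈ P.points,
            dist (x N j) (x N i + A (p - q)) ≤ ε'))} : ℝ) / N ≤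
        K * ((Nat.card {k : Fin N // ¬ ShellCloseTo η (shell a (x N) k) (target a t)} : ℝ) / N) := by
    intro N hN
    have hNr : (0 : ℝ) < N := by exact_mod_cast hN
    have hgs : IsGroundState lennardJones (x N) := hx N
    have hsepN : ∀ i j, i ≠ j → (7 : ℝ) / 10 ≤ dist (x N i) (x N j) :=
      LjLaminarWindowsSketch.stub_minDistance07 N (x N) hgs
    -- fake site energies: `e_∞` on good shells, `e_∞ + 1` on bad shells
    set bad : ℝ := (Nat.card {k : Fin N // ¬ ShellCloseTo η (shell a (x N) k) (target a t)} : ℝ)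
      with hbad_def
    set W : Fin N → ℝ := fun k =>
      eInf + (if ¬ ShellCloseTo η (shell a (x N) k) (target a t) then 1 else 0) with hW_def
    have hfeas : ∀ k, eInf ≤ W k := by
      intro k
      simp only [hW_def]
      split_ifs <;> linarith
    have hsumeq : ∑ k, W k = N * eInf + bad := by
      simp only [hW_def]
      rw [Finset.sum_add_distrib, Finset.sum_const, Finset.card_univ, Fintype.card_fin, nsmul_eq_mul,
        Finset.sum_boole, hbad_def, Nat.card_eq_fintype_card, Fintype.card_subtype]
    have hsum : ∑ k, W k ≤ N * eInf + bad := le_of_eq hsumeq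
    have hstrict : ∀ k, W k < eInf + 1 → ShellCloseTo η (shell a (x N) k) (target a t) := by
      intro k hk
      by_contra hk'
      exact absurd hk (by simp [hW_def, hk'])
    have hcnt := defectVanishOfStrict_count W eInf 1 (N * eInf + bad) K one_pos hK _ _ _
      hfeas hsum hstrict (hL N (x N) hsepN)
      (defectVanishOfStrict_card_near_le (x N) hgs.1 (by norm_num : (0 : ℝ) < 7 / 10) hsepN L)
    calc _ ≤ K / 1 * (N * eInf + bad - N * eInf) / N := div_le_div_of_nonneg_right hcnt hNr.le
      _ = K * (bad / N) := by rw [div_one, add_sub_cancel_left, mul_div_assoc]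
  refine squeeze_zero' (Eventually.of_forall fun N => by positivity)
    ((eventually_gt_atTop 0).mono main) ?_
  have hlim := hlimH.const_mul K
  rwa [mul_zero] at hlim

-- NOTE (landing): the node's `defectVanishOfStrict_via_kernel : DefectVanishOfStrict :=
--   fun h₁ h₂ => defectVanish_of_hcpShellDefectVanish (hcpShellDefectVanish_of_strictSplittingRule h₁) h₂`
-- (the route's glue item 12566 re-derived THROUGH THE KERNEL) is omitted from the tree copy: its statement is
-- literally the landed `defectVanishOfStrict_proof` (gate `dedup.landed`); the two-line term above is the record.

/-- **`H ⟹ Crystallization` (conjunct BY NAME) with EXACTLY the binder list of the route's `closes` except that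
`(h₁ : StrictSplittingRule) (h₃ : DefectVanishOfStrict)` are replaced by `(h : HcpShellDefectVanish)`** — the
other binders `ShellRigidityHcp` (item 12561, `shellRigidityHcp_proof`, p148531), `DefectVanishCrystallizes`,
`DefectVanishEnergy`, `PeriodicUpperBound` are all PROVED route items (their proof modules
`…FreeSplittingCertificates{ShellRigidityHcp,DefectVanishCrystallizes,DefectVanishEnergy,PeriodicUpperBound}` are
cited by name rather than imported only because parts of their import cones were unbuilt on the farm when this
node was checked).  Same two lines as `closes`.  So the density statement `H` ALONE carries the whole OPEN content
of route `FreeSplittingCertificates`. [folklore] -/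
theorem crystallization_of_hcpShellDefectVanish (h : HcpShellDefectVanish) (h₂ : ShellRigidityHcp)
    (h₄ : DefectVanishCrystallizes) (h₅ : DefectVanishEnergy) (h₆ : PeriodicUpperBound) :
    _root_.Crystallization := by
  obtain ⟨P, hP⟩ := defectVanish_of_hcpShellDefectVanish h h₂
  show HasPeriodicGroundStateEnergy lennardJones 3 ∧ IsCrystallizing lennardJones 3
  exact ⟨h₅ h₆ P hP, h₄ P hP⟩

/-- Re-derivation of `closes` through the kernel: `12560 ⟹ H ⟹ Crystallization`, binders as in `closes` minus
`h₃ : DefectVanishOfStrict` (a theorem: `defectVanishOfStrict_proof`, or through the kernel as noted above). [folklore] -/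
theorem crystallization_of_strictSplittingRule_via_kernel (h₁ : StrictSplittingRule) (h₂ : ShellRigidityHcp)
    (h₄ : DefectVanishCrystallizes) (h₅ : DefectVanishEnergy) (h₆ : PeriodicUpperBound) :
    _root_.Crystallization :=
  crystallization_of_hcpShellDefectVanish (hcpShellDefectVanish_of_strictSplittingRule h₁) h₂ h₄ h₅ h₆

end Summit.AtomisticToContinuum.Crystallization.Theorems.StrictSplittingOnPathKernel

end
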